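import Summits.HodgeConjecture.HodgeConjecture.Theorems.MarkmanPartnerTransportIsometrySpannedThirdClassEndomorphism
import Summits.HodgeConjecture.HodgeConjecture.Theorems.MarkmanPartnerTransportIsometrySpannedThirdProjection
import Summits.HodgeConjecture.HodgeConjecture.Theorems.MarkmanPartnerTransportPartnerExistenceBBFNondegenerate
import Literature.AlgebraicGeometry.HodgeTheory.ArapuraSurfaceFibredFourfoldsProofs
import Literature.AlgebraicGeometry.HodgeTheory.HardLefschetzNFoldHolds
import Literature.AlgebraicGeometry.HodgeTheory.ComplexConjugationHolds
import Literature.AlgebraicGeometry.HodgeTheory.SupportedClassesRationalProofs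
import Mathlib.LinearAlgebra.QuadraticForm.Basic

/-!
# Route MarkmanPartnerTransport · support #3 `IsometrySpannedThird` — the `E = ℚ` THIRD AT EVERY PICARD RANK,
# PARTNER-FREE: HC⁴ for marked `K3^{[2]}`-type fourfolds with `End_Hdg T(X) = ℚ`

For a marked smooth projective `K3^{[2]}`-type fourfold `(X, φ, P, z)` such that every rational Hodge endomorphism
of `H²(X)` killing `N¹(X)` with `q`-transcendental image is a rational scalar on `T(X)` (the `k = 1` instance of
`SpannedByIsometries X φ`), every rational `(2,2)`-class `c ∈ H⁴(X)` is algebraic — with NO K3 partner and NO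
Markman transport, at EVERY Picard rank (so also for `ρ(X) ≤ 3`): the endomorphism `F_c` of `c`
(`(c ∪ y) ∪ w = q(φ F_c y, φ w)·P`, `…ClassEndomorphism`) is block-diagonal for `H² = N¹ ⊕ T` and a rational
scalar `a` on `T` (`exists_transcendentalScalar_of_classEndomorphism`), so `q(F_c y, w) = a·q(y,w) + β(y_N, w_N)`
with `β` symmetric on `N¹`; such a cubic form is that of an ALGEBRAIC combination of products of divisor classes
and O'Grady's `q^∨` (`exists_algebraicClass_of_symmetricForm`); uniqueness of `c` given `F_c` (Verbitsky–Guan +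
Poincaré duality, `eq_of_cup3_eq`) concludes: `mem_algebraicClasses_two_of_hodgeEndomorphisms_scalar`, and
`hodgeConjectureFor_of_hodgeEndomorphisms_scalar` — **HC⁴(X) in every degree**, modulo
{`VerbitskyGuan_cohomology_K3HilbertSquareType`, `OGrady2008_dualBBFClass_algebraic`,
`Voisin2003_cupProduct_algebraicClasses`} only (no Markman, no period surjectivity). No definition, no sorry.
References: S. Novario, Kyoto J. Math. 66 (2026) Thm. 6.2 (the Hilbert-square case in print); K. O'Grady,
*Mat. Contemp.* (2008) §3; M. Verbitsky, GAFA 6 (1996) / D. Guan, MRL 8 (2001); C. Voisin, *Hodge Theory II*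
Prop. 9.20; Yu. Zarhin, J. reine angew. Math. 341 (1983) Thm. 1.5.1.
-/

noncomputable section

set_option linter.dupNamespace false

open Module CategoryTheory
open Literature.AlgebraicTopology.SingularHomology Literature.Geometry.Kaehler
open Literature.AlgebraicGeometry Literature.AlgebraicGeometry.Motives Literature.AlgebraicGeometry.HodgeTheory
open Literature.AlgebraicGeometry.Hyperkaehler Literature.AlgebraicGeometry.Surfaces
open Summit.HodgeConjecture.HodgeConjecture.Theorems.NikulinTwinTransport
open Summit.HodgeConjecture.HodgeConjecture.Theorems.MarkmanPartnerTransport.BBFPositivity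

namespace Summit.HodgeConjecture.HodgeConjecture.Theorems.MarkmanPartnerTransport.PartnerLattice

/-- `MarkedK3Sq[X, φ, P, z]`: VERBATIM the `let MarkedK3Sq := …` binder of the route declarations of
MarkmanPartnerTransport (clauses (m1)–(m6)). Local notation only. -/
local notation3 (prettyPrint := false) "MarkedK3Sq[" X ", " φ ", " P ", " z "]" =>
  (((IsIntegralClass P ∧ ∀ Q : complexBetti X (2 * 4), IsIntegralClass Q → ∃ n : ℤ, Q = n • P) ∧
    (∀ c : complexBetti X 2, IsIntegralClass c ↔ ∃ v : K3HilbertIndex → ℤ, φ c = fun i => (v i : ℂ)) ∧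
    (∀ a : complexBetti X 2, cupPowTwo a 4 = ((3 : ℂ) * (k3HilbertForm 2 (φ a) (φ a)) ^ 2) • P) ∧
    (IsOfHodgeType 4 X 2 2 0 (LinearEquiv.symm φ z) ∧
      ∀ τ : complexBetti X 2, IsOfHodgeType 4 X 2 2 0 τ → ∃ t : ℂ, τ = t • LinearEquiv.symm φ z) ∧
    (∀ c : complexBetti X 2, IsOfHodgeType 4 X 2 1 1 c ↔
      (k3HilbertForm 2 (φ c) z = 0 ∧ k3HilbertForm 2 (φ c) (star z) = 0)) ∧
    (k3HilbertForm 2 z z = 0 ∧ 0 < (k3HilbertForm 2 (star z) z).re)))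

/-- `Cup3[c, y, w] = (c ∪ y) ∪ w ∈ H⁸` for `c ∈ H⁴`, `y, w ∈ H²`. Local notation only. -/
local notation3 (prettyPrint := false) "Cup3[" c ", " y ", " w "]" =>
  cupProduct (rfl : 2 * 3 + 2 = 2 * 4) (cupProduct (rfl : 2 * 2 + 2 = 2 * 3) c y) w

variable {X : SchemeOver ℂ} {φ : complexBetti X 2 ≃ₗ[ℂ] (K3HilbertIndex → ℂ)} {P : complexBetti X (2 * 4)}
  {z : K3HilbertIndex → ℂ}

/-- `hQX[X, φ]`: the `E = ℚ` hypothesis — every rational Hodge endomorphism of `H²(X)` killing `N¹(X)` with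
`q`-transcendental image is a rational scalar on `T(X)` (`k = 1` in `SpannedByIsometries X φ`). Local notation. -/
local notation3 (prettyPrint := false) "hQX[" X ", " φ "]" =>
  ∀ f : complexBetti X 2 →ₗ[ℂ] complexBetti X 2,
    (∀ y, IsRationalClass y → IsRationalClass (f y)) →
    (∀ (i j : ℕ) y, IsOfHodgeType 4 X 2 i j y → IsOfHodgeType 4 X 2 i j (f y)) →
    (∀ d : complexBetti X 2, d ∈ algebraicClasses X 1 → f d = 0) →
    (∀ y : complexBetti X 2, ∀ d : complexBetti X 2, d ∈ algebraicClasses X 1 →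
      k3HilbertForm 2 (φ (f y)) (φ d) = 0) →
    ∃ a : ℚ, ∀ y : complexBetti X 2,
      (∀ d : complexBetti X 2, d ∈ algebraicClasses X 1 → k3HilbertForm 2 (φ y) (φ d) = 0) →
      f y = (a : ℂ) • y

/-- **Block form of the class endomorphism.** For a rational `(2,2)`-class `c` with endomorphism `F` and the
transcendental projector `π_T` (`exists_transcendentalProjector`): `π_T F` kills `N¹(X)` (a rational
transcendental `(1,1)`-class is algebraic by Lefschetz `(1,1)` and dies by the non-degeneracy of `q` on `N¹`),
`π_T F π_T` is a rational scalar `a` on `T(X)` by the `E = ℚ` hypothesis, and (`F` being `q`-self-adjoint)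
`q(F y, w) = a·q(y, w) + (q(F y_N, w_N) − a·q(y_N, w_N))`, `y_N = y − π_T y ∈ N¹(X)`.
[cite: Zarhin1983HodgeGroupsK3, Thm. 1.5.1] [cite: Novario2026HodgeClassesHilbertSquares, Thm. 6.2] -/
theorem exists_transcendentalScalar_of_classEndomorphism
    (hX : IsSmoothProjective 4 X) (hM : MarkedK3Sq[X, φ, P, z]) (hQX : hQX[X, φ])
    {c : complexBetti X (2 * 2)} (hcrat : IsRationalClass c) (hc22 : IsOfHodgeType 4 X (2 * 2) 2 2 c)
    {F : complexBetti X 2 →ₗ[ℂ] complexBetti X 2}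
    (hF : ∀ y w : complexBetti X 2, Cup3[c, y, w] = (k3HilbertForm 2 (φ (F y)) (φ w)) • P) :
    ∃ (πT : complexBetti X 2 →ₗ[ℂ] complexBetti X 2) (a : ℚ),
      (∀ y : complexBetti X 2, y - πT y ∈ algebraicClasses X 1) ∧
      (∀ n ∈ algebraicClasses X 1, ∀ w : complexBetti X 2, k3HilbertForm 2 (φ n) (φ (πT w)) = 0) ∧
      ∀ y w : complexBetti X 2, k3HilbertForm 2 (φ (F y)) (φ w) =
        (a : ℂ) * k3HilbertForm 2 (φ y) (φ w) +
          (k3HilbertForm 2 (φ (F (y - πT y))) (φ (w - πT w)) -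
            (a : ℂ) * k3HilbertForm 2 (φ (y - πT y)) (φ (w - πT w))) := by
  classical
  have hFrat : ∀ y, IsRationalClass y → IsRationalClass (F y) :=
    fun y hy => isRationalClass_classEndomorphism hX hM hF hcrat hy
  have hFh : ∀ (i j : ℕ) y, IsOfHodgeType 4 X 2 i j y → IsOfHodgeType 4 X 2 i j (F y) :=
    fun i j y hy => isOfHodgeType_classEndomorphism hX hM hF hc22 hy
  have hFadj : ∀ y w, k3HilbertForm 2 (φ (F y)) (φ w) = k3HilbertForm 2 (φ y) (φ (F w)) :=
    classEndomorphism_selfAdjoint hX hM hF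
  obtain ⟨πT, hT1, hT2, hT3, hT4, hT5, hT6, hT7⟩ := exists_transcendentalProjector hX hM
  have hN11 : ∀ d ∈ algebraicClasses X 1, IsOfHodgeType 4 X 2 1 1 d := fun d hd =>
    isOfHodgeType_of_mem_algebraicClasses_of_isSmoothProjective hX 1 hd
  have hNT : ∀ n ∈ algebraicClasses X 1, ∀ w, k3HilbertForm 2 (φ n) (φ (πT w)) = 0 := fun n hn w => by
    rw [k3HilbertForm_comm]; exact hT3 w n hn
  -- Claim A: `πT (F d) = 0` for `d ∈ N¹(X)`
  have hA : ∀ d ∈ algebraicClasses X 1, πT (F d) = 0 := by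
    have hspan := supportedClasses_eq_span_isRationalClass hX 2 1
    change algebraicClasses X 1 = Submodule.span ℂ
      {c : complexBetti X 2 | IsRationalClass c ∧ c ∈ algebraicClasses X 1} at hspan
    intro d hd
    rw [hspan] at hd
    have hle : Submodule.span ℂ {c : complexBetti X 2 | IsRationalClass c ∧ c ∈ algebraicClasses X 1} ≤
        LinearMap.ker (πT ∘ₗ F) := by
      refine Submodule.span_le.2 ?_
      rintro d ⟨hdrat, hdalg⟩
      rw [SetLike.mem_coe, LinearMap.mem_ker, LinearMap.comp_apply]
      have hu_alg : πT (F d) ∈ algebraicClasses X 1 :=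
        lefschetzOneOne_rational_holds hX _ (hT5 _ (hFrat _ hdrat)) (hT7 1 1 _ (hFh 1 1 _ (hN11 d hdalg)))
      exact k3HilbertForm_radical_algebraicClasses_one_eq_zero hX hM hu_alg (hT3 (F d))
    simpa only [LinearMap.mem_ker, LinearMap.comp_apply] using hle hd
  -- Claim C: `πT F πT` is a rational scalar `a` on `T(X)`
  obtain ⟨a, ha⟩ := hQX (πT ∘ₗ F ∘ₗ πT)
    (fun y hy => by rw [LinearMap.comp_apply, LinearMap.comp_apply]; exact hT5 _ (hFrat _ (hT5 _ hy)))
    (fun i j y hy => by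
      rw [LinearMap.comp_apply, LinearMap.comp_apply]; exact hT7 i j _ (hFh i j _ (hT7 i j _ hy)))
    (fun d hd => by rw [LinearMap.comp_apply, LinearMap.comp_apply, hT1 d hd, map_zero, map_zero])
    (fun y d hd => by rw [LinearMap.comp_apply, LinearMap.comp_apply]; exact hT3 _ d hd)
  refine ⟨πT, a, hT4, hNT, fun y w => ?_⟩
  -- `q(F (πT y), w) = a · q(πT y, w)`
  have hTT : k3HilbertForm 2 (φ (F (πT y))) (φ w) = (a : ℂ) * k3HilbertForm 2 (φ (πT y)) (φ w) := by
    have hw : w = (w - πT w) + πT w := by abel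
    have h1 : k3HilbertForm 2 (φ (F (πT y))) (φ (w - πT w)) = 0 := by
      rw [hFadj, k3HilbertForm_comm, ← hT6, hA _ (hT4 w), map_zero, k3HilbertForm_comm, k3HilbertForm_apply]
      simp
    have h2 : k3HilbertForm 2 (φ (F (πT y))) (φ (πT w)) =
        (a : ℂ) * k3HilbertForm 2 (φ (πT y)) (φ (πT w)) := by
      have e1 : πT (F (πT y)) = (a : ℂ) • πT y := by
        have := ha (πT y) (hT3 y)
        rwa [LinearMap.comp_apply, LinearMap.comp_apply, hT2 (πT y) (hT3 y)] at this
      rw [← hT6, e1, map_smul, k3HilbertForm_smul_left, hT6 y w, hT6 y (πT w), hT2 (πT w) (hT3 w)]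
    have h3 : k3HilbertForm 2 (φ (πT y)) (φ (w - πT w)) = 0 := by
      rw [k3HilbertForm_comm]; exact hNT _ (hT4 w) _
    conv_lhs => rw [hw, map_add, k3HilbertForm_add_right, h1, zero_add, h2]
    conv_rhs => rw [hw, map_add, k3HilbertForm_add_right, h3, zero_add]
  -- `q(F y_N, πT w) = 0`
  have hNT' : k3HilbertForm 2 (φ (F (y - πT y))) (φ (πT w)) = 0 := by
    rw [← hT6, hA _ (hT4 y), map_zero, k3HilbertForm_apply]; simp
  have hy : y = (y - πT y) + πT y := by abel
  have hw : w = (w - πT w) + πT w := by abel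
  have lhs : k3HilbertForm 2 (φ (F y)) (φ w) =
      k3HilbertForm 2 (φ (F (y - πT y))) (φ (w - πT w)) +
        (a : ℂ) * k3HilbertForm 2 (φ (πT y)) (φ w) := by
    conv_lhs => rw [hy, map_add, map_add, k3HilbertForm_add_left, hTT]
    congr 1
    conv_lhs => rw [hw, map_add, k3HilbertForm_add_right, hNT', add_zero]
  have qsplit : k3HilbertForm 2 (φ y) (φ w) =
      k3HilbertForm 2 (φ (y - πT y)) (φ (w - πT w)) + k3HilbertForm 2 (φ (πT y)) (φ w) := by
    conv_lhs => rw [hy, map_add, k3HilbertForm_add_left]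
    congr 1
    conv_lhs => rw [hw, map_add, k3HilbertForm_add_right, hNT _ (hT4 y) w, add_zero]
  rw [lhs, qsplit]; ring

/-- **A symmetric bilinear form on `N¹(X)` plus a multiple of `q` is the cubic form of an ALGEBRAIC class**:
for `a ∈ ℂ`, a symmetric bilinear `β` and `r : H² → N¹(X)` with `q(n, r y) = q(n, y)` (`n ∈ N¹(X)`) there is
`c' ∈ A²(X)` with `(c' ∪ y) ∪ w = (a·q(y,w) + β(r y, r w))·P` — in a `q`-orthogonal basis `(vₖ)` of `N¹(X)`
(`q(vₖ,vₖ) ≠ 0` by non-degeneracy), `β(r y, r w) = Σ sₖₗ q(vₖ,y) q(vₗ,w)` and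
`c' := Σ sₖₗ/2 · vₖ ∪ vₗ + ((a − Σ sₖₗ q(vₖ,vₗ)/2)/25) · q^∨` works by polarised Fujiki (`cupFour_eq_of_isMarkedK3Hilb`)
and O'Grady's `(q^∨ ∪ y) ∪ w = 25 q(y,w)·P`. [cite: OGrady2008NumericalK3Square, §3]
[cite: Novario2026HodgeClassesHilbertSquares, Props. 4.2–4.4 (p. 4)] [cite: VoisinHodgeII2003, Prop. 9.20] -/
theorem exists_algebraicClass_of_symmetricForm
    (hO : OGrady2008_dualBBFClass_algebraic) (hcup : Voisin2003_cupProduct_algebraicClasses)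
    (hX : IsSmoothProjective 4 X) (hK : IsOfK3HilbertSquareType X) (hM : MarkedK3Sq[X, φ, P, z])
    (a : ℂ) (β : complexBetti X 2 →ₗ[ℂ] complexBetti X 2 →ₗ[ℂ] ℂ) (hβsymm : ∀ y w, β y w = β w y)
    (r : complexBetti X 2 → complexBetti X 2) (hr : ∀ y, r y ∈ algebraicClasses X 1)
    (hqr : ∀ n ∈ algebraicClasses X 1, ∀ y : complexBetti X 2,
      k3HilbertForm 2 (φ n) (φ (r y)) = k3HilbertForm 2 (φ n) (φ y)) :
    ∃ c' ∈ algebraicClasses X 2, ∀ y w : complexBetti X 2,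
      Cup3[c', y, w] = (a * k3HilbertForm 2 (φ y) (φ w) + β (r y) (r w)) • P := by
  classical
  have hmk : IsMarkedK3Hilb 2 X φ P := isMarkedK3Hilb_of_marked hM
  haveI : FiniteDimensional ℂ (complexBetti X 2) := LinearEquiv.finiteDimensional φ.symm
  set N : Submodule ℂ (complexBetti X 2) := algebraicClasses X 1 with hNdef
  -- the restriction `qN` of `q` to `N` and a `q`-orthogonal basis `v` of `N`
  set qN : LinearMap.BilinForm ℂ N := LinearMap.BilinForm.restrict
    ((Matrix.toBilin' (Matrix.map (k3HilbertGram 2) (Int.cast : ℤ → ℂ))).compl₁₂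
      (φ : complexBetti X 2 →ₗ[ℂ] (K3HilbertIndex → ℂ)) (φ : complexBetti X 2 →ₗ[ℂ] (K3HilbertIndex → ℂ))) N
  have hqNapp : ∀ m n : N, qN m n = k3HilbertForm 2 (φ (m : complexBetti X 2)) (φ (n : complexBetti X 2)) :=
    fun m n => by rw [LinearMap.BilinForm.restrict_apply, LinearMap.domRestrict_apply,
      LinearMap.compl₁₂_apply, qC_apply]; rfl
  have hqNsymm : LinearMap.IsSymm qN := ⟨fun m n => by
    show qN m n = qN n m
    rw [hqNapp, hqNapp, k3HilbertForm_comm]⟩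
  haveI : Invertible (2 : ℂ) := invertibleOfNonzero two_ne_zero
  obtain ⟨v, hv⟩ := LinearMap.BilinForm.exists_orthogonal_basis (B := qN) hqNsymm
  have hvN : ∀ k, (v k : complexBetti X 2) ∈ algebraicClasses X 1 := fun k => (v k).2
  obtain ⟨cv, hcv⟩ : ∃ cv : Fin (Module.finrank ℂ N) → ℂ,
      ∀ k, cv k = k3HilbertForm 2 (φ (v k : complexBetti X 2)) (φ (v k : complexBetti X 2)) :=
    ⟨fun k => k3HilbertForm 2 (φ (v k : complexBetti X 2)) (φ (v k : complexBetti X 2)), fun _ => rfl⟩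
  have hvorth : ∀ k l, k ≠ l →
      k3HilbertForm 2 (φ (v k : complexBetti X 2)) (φ (v l : complexBetti X 2)) = 0 := by
    intro k l hkl
    have := hv hkl
    simp only [Function.onFun] at this
    rwa [hqNapp] at this
  have hcv0 : ∀ k, cv k ≠ 0 := by
    intro k h0
    rw [hcv] at h0
    have hℓ : qN (v k) = 0 := v.ext fun l => by
      rw [LinearMap.zero_apply, hqNapp]
      by_cases hkl : k = l
      · subst hkl; exact h0
      · exact hvorth k l hkl
    have hperp : ∀ d ∈ algebraicClasses X 1, k3HilbertForm 2 (φ (v k : complexBetti X 2)) (φ d) = 0 := by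
      intro d hd
      have := LinearMap.congr_fun hℓ ⟨d, hd⟩
      rwa [hqNapp, LinearMap.zero_apply] at this
    have h00 := k3HilbertForm_radical_algebraicClasses_one_eq_zero hX hM (hvN k) hperp
    exact v.ne_zero k (Subtype.ext h00)
  -- expansion of elements of `N` in the orthogonal basis: `n = Σ cₖ⁻¹ q(vₖ, n) vₖ`
  have hcoefN : ∀ (m : N) (k : Fin (Module.finrank ℂ N)),
      v.repr m k * cv k = k3HilbertForm 2 (φ (v k : complexBetti X 2)) (φ (m : complexBetti X 2)) := by
    intro m k
    have h := congrArg (qN (v k)) (v.sum_repr m).symm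
    rw [map_sum] at h
    simp only [map_smul, smul_eq_mul] at h
    rw [Finset.sum_eq_single k (fun l _ hlk => by rw [hv (Ne.symm hlk), mul_zero])
      (fun hk => absurd (Finset.mem_univ k) hk)] at h
    rw [hqNapp, hqNapp] at h
    rw [hcv, h, mul_comm]
  have hexp : ∀ m : N, (m : complexBetti X 2) = ∑ k, ((cv k)⁻¹ *
      k3HilbertForm 2 (φ (v k : complexBetti X 2)) (φ (m : complexBetti X 2))) • (v k : complexBetti X 2) := by
    intro m
    have hrepr := congrArg (Subtype.val : N → complexBetti X 2) (v.sum_repr m).symm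
    conv_lhs => rw [hrepr]
    rw [Submodule.coe_sum]
    refine Finset.sum_congr rfl fun k _ => ?_
    rw [Submodule.coe_smul, ← hcoefN m k, mul_comm (v.repr m k) (cv k), ← mul_assoc,
      inv_mul_cancel₀ (hcv0 k), one_mul]
  have hexp' : ∀ u : complexBetti X 2, u ∈ algebraicClasses X 1 → u = ∑ k, ((cv k)⁻¹ *
      k3HilbertForm 2 (φ (v k : complexBetti X 2)) (φ u)) • (v k : complexBetti X 2) :=
    fun u hu => hexp ⟨u, hu⟩
  obtain ⟨s, hsdef⟩ : ∃ s : Fin (Module.finrank ℂ N) → Fin (Module.finrank ℂ N) → ℂ, ∀ k l,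
      s k l = (cv k)⁻¹ * (cv l)⁻¹ * β (v k : complexBetti X 2) (v l : complexBetti X 2) :=
    ⟨fun k l => (cv k)⁻¹ * (cv l)⁻¹ * β (v k : complexBetti X 2) (v l : complexBetti X 2), fun _ _ => rfl⟩
  have hssymm : ∀ k l, s k l = s l k := fun k l => by rw [hsdef, hsdef, hβsymm]; ring
  -- `β(r y, r w) = Σ s_kl q(v_k, y) q(v_l, w)`
  have hβexp : ∀ y w, β (r y) (r w) =
      ∑ k, ∑ l, s k l * k3HilbertForm 2 (φ (v k : complexBetti X 2)) (φ y) *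
        k3HilbertForm 2 (φ (v l : complexBetti X 2)) (φ w) := by
    intro y w
    have hy := hexp' _ (hr y)
    have hw := hexp' _ (hr w)
    conv_lhs => rw [hy, hw]
    rw [LinearMap.map_sum₂]
    refine Finset.sum_congr rfl fun k _ => ?_
    rw [LinearMap.map_smul₂, map_sum, smul_eq_mul, Finset.mul_sum]
    refine Finset.sum_congr rfl fun l _ => ?_
    rw [map_smul, smul_eq_mul, hqr _ (hvN k), hqr _ (hvN l), hsdef]
    ring
  obtain ⟨qd, hqdalg, -, hqd⟩ := OGrady2008_dualBBFClass_algebraic.exists_cup_cup_eq hO hX hK hmk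
  obtain ⟨t, htdef⟩ : ∃ t : ℂ, t = (a - ∑ k, ∑ l, s k l / 2 *
      k3HilbertForm 2 (φ (v k : complexBetti X 2)) (φ (v l : complexBetti X 2))) / 25 := ⟨_, rfl⟩
  obtain ⟨c', hc'def⟩ : ∃ c' : complexBetti X (2 * 2), c' = (∑ k, ∑ l, (s k l / 2) •
      cupProduct (rfl : 2 + 2 = 2 * 2) (v k : complexBetti X 2) (v l : complexBetti X 2)) + t • qd :=
    ⟨_, rfl⟩
  have hc'alg : c' ∈ algebraicClasses X 2 := by
    rw [hc'def]
    refine Submodule.add_mem _ (Submodule.sum_mem _ fun k _ => Submodule.sum_mem _ fun l _ =>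
      Submodule.smul_mem _ _ ?_) (Submodule.smul_mem _ _ hqdalg)
    exact hcup hX (a := 1) (b := 1) (hvN k) (hvN l)
  refine ⟨c', hc'alg, fun y w => ?_⟩
  have hL1 : ∀ A B : complexBetti X (2 * 2), Cup3[A + B, y, w] = Cup3[A, y, w] + Cup3[B, y, w] := by
    intro A B; simp only [map_add, LinearMap.add_apply]
  have hL2 : ∀ (u : ℂ) (A : complexBetti X (2 * 2)), Cup3[u • A, y, w] = u • Cup3[A, y, w] := by
    intro u A; simp only [map_smul, LinearMap.smul_apply]
  have hL3 : ∀ A : Fin (Module.finrank ℂ N) → complexBetti X (2 * 2),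
      Cup3[∑ k, A k, y, w] = ∑ k, Cup3[A k, y, w] := by
    intro A; simp only [map_sum, LinearMap.sum_apply]
  have hvv : ∀ k l,
      Cup3[cupProduct (rfl : 2 + 2 = 2 * 2) (v k : complexBetti X 2) (v l : complexBetti X 2), y, w] =
        (k3HilbertForm 2 (φ (v k : complexBetti X 2)) (φ (v l : complexBetti X 2)) *
              k3HilbertForm 2 (φ y) (φ w) +
            k3HilbertForm 2 (φ (v k : complexBetti X 2)) (φ y) *
              k3HilbertForm 2 (φ (v l : complexBetti X 2)) (φ w) +
          k3HilbertForm 2 (φ (v k : complexBetti X 2)) (φ w) *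
            k3HilbertForm 2 (φ (v l : complexBetti X 2)) (φ y)) • P :=
    fun k l => (cupFour_def _ _ _ _).symm.trans (cupFour_eq_of_isMarkedK3Hilb hmk _ _ _ _)
  have hrhs : Cup3[c', y, w] = ((∑ k, ∑ l, (s k l / 2) *
      (k3HilbertForm 2 (φ (v k : complexBetti X 2)) (φ (v l : complexBetti X 2)) *
            k3HilbertForm 2 (φ y) (φ w) +
          k3HilbertForm 2 (φ (v k : complexBetti X 2)) (φ y) *
            k3HilbertForm 2 (φ (v l : complexBetti X 2)) (φ w) +
        k3HilbertForm 2 (φ (v k : complexBetti X 2)) (φ w) *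
          k3HilbertForm 2 (φ (v l : complexBetti X 2)) (φ y))) +
      t * ((25 : ℂ) * k3HilbertForm 2 (φ y) (φ w))) • P := by
    rw [hc'def, hL1, hL3, hL2, hqd, smul_smul, add_smul, Finset.sum_smul]
    congr 1
    refine Finset.sum_congr rfl fun k _ => ?_
    rw [hL3, Finset.sum_smul]
    refine Finset.sum_congr rfl fun l _ => ?_
    rw [hL2, hvv, smul_smul]
  -- the scalar identity
  have hsum2 : ∑ k, ∑ l, (s k l / 2) *
      (k3HilbertForm 2 (φ (v k : complexBetti X 2)) (φ y) * k3HilbertForm 2 (φ (v l : complexBetti X 2)) (φ w) +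
        k3HilbertForm 2 (φ (v k : complexBetti X 2)) (φ w) * k3HilbertForm 2 (φ (v l : complexBetti X 2)) (φ y)) =
      ∑ k, ∑ l, s k l * k3HilbertForm 2 (φ (v k : complexBetti X 2)) (φ y) *
        k3HilbertForm 2 (φ (v l : complexBetti X 2)) (φ w) := by
    have hswap : ∑ k, ∑ l, (s k l / 2) * (k3HilbertForm 2 (φ (v k : complexBetti X 2)) (φ w) *
        k3HilbertForm 2 (φ (v l : complexBetti X 2)) (φ y)) =
        ∑ k, ∑ l, (s k l / 2) * (k3HilbertForm 2 (φ (v k : complexBetti X 2)) (φ y) *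
        k3HilbertForm 2 (φ (v l : complexBetti X 2)) (φ w)) := by
      rw [Finset.sum_comm]
      exact Finset.sum_congr rfl fun k _ => Finset.sum_congr rfl fun l _ => by rw [hssymm l k]; ring
    simp only [mul_add, Finset.sum_add_distrib]
    rw [hswap, ← Finset.sum_add_distrib]
    refine Finset.sum_congr rfl fun k _ => ?_
    rw [← Finset.sum_add_distrib]
    exact Finset.sum_congr rfl fun l _ => by ring
  have hsplit : ∑ k, ∑ l, (s k l / 2) *
      (k3HilbertForm 2 (φ (v k : complexBetti X 2)) (φ (v l : complexBetti X 2)) * k3HilbertForm 2 (φ y) (φ w) +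
          k3HilbertForm 2 (φ (v k : complexBetti X 2)) (φ y) * k3HilbertForm 2 (φ (v l : complexBetti X 2)) (φ w) +
        k3HilbertForm 2 (φ (v k : complexBetti X 2)) (φ w) * k3HilbertForm 2 (φ (v l : complexBetti X 2)) (φ y)) =
      (∑ k, ∑ l, s k l / 2 * k3HilbertForm 2 (φ (v k : complexBetti X 2)) (φ (v l : complexBetti X 2))) *
          k3HilbertForm 2 (φ y) (φ w) +
        ∑ k, ∑ l, (s k l / 2) *
          (k3HilbertForm 2 (φ (v k : complexBetti X 2)) (φ y) * k3HilbertForm 2 (φ (v l : complexBetti X 2)) (φ w) +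
            k3HilbertForm 2 (φ (v k : complexBetti X 2)) (φ w) *
              k3HilbertForm 2 (φ (v l : complexBetti X 2)) (φ y)) := by
    rw [Finset.sum_mul, ← Finset.sum_add_distrib]
    refine Finset.sum_congr rfl fun k _ => ?_
    rw [Finset.sum_mul, ← Finset.sum_add_distrib]
    exact Finset.sum_congr rfl fun l _ => by ring
  rw [hrhs, hβexp, hsplit, hsum2, htdef]
  congr 1
  ring

/-- **The `E = ℚ` third of `IsometrySpannedThird` in degree `4`, partner-free, at every Picard rank**: a rational
`(2,2)`-class on a marked smooth projective `K3^{[2]}`-type fourfold whose transcendental lattice has only scalar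
rational Hodge endomorphisms is algebraic. [cite: Novario2026HodgeClassesHilbertSquares, Thm. 6.2]
[cite: OGrady2008NumericalK3Square, §3] [cite: Zarhin1983HodgeGroupsK3, Thm. 1.5.1] -/
theorem mem_algebraicClasses_two_of_hodgeEndomorphisms_scalar
    (hV : VerbitskyGuan_cohomology_K3HilbertSquareType) (hO : OGrady2008_dualBBFClass_algebraic)
    (hcup : Voisin2003_cupProduct_algebraicClasses)
    (hX : IsSmoothProjective 4 X) (hK : IsOfK3HilbertSquareType X) (hM : MarkedK3Sq[X, φ, P, z])
    (hQX : hQX[X, φ]) {c : complexBetti X (2 * 2)} (hcrat : IsRationalClass c)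
    (hc22 : IsOfHodgeType 4 X (2 * 2) 2 2 c) : c ∈ algebraicClasses X 2 := by
  classical
  obtain ⟨F, hF⟩ := exists_classEndomorphism hX hM c
  have hFadj : ∀ y w, k3HilbertForm 2 (φ (F y)) (φ w) = k3HilbertForm 2 (φ y) (φ (F w)) :=
    classEndomorphism_selfAdjoint hX hM hF
  obtain ⟨πT, a, hT4, hNT, hβ⟩ := exists_transcendentalScalar_of_classEndomorphism hX hM hQX hcrat hc22 hF
  -- the bilinear form `β(y, w) = q(F y, w) − a q(y, w)`
  set qXform : LinearMap.BilinForm ℂ (complexBetti X 2) :=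
    (Matrix.toBilin' (Matrix.map (k3HilbertGram 2) (Int.cast : ℤ → ℂ))).compl₁₂
      (φ : complexBetti X 2 →ₗ[ℂ] (K3HilbertIndex → ℂ)) (φ : complexBetti X 2 →ₗ[ℂ] (K3HilbertIndex → ℂ))
    with hqXform
  have hqXapp : ∀ y w, qXform y w = k3HilbertForm 2 (φ y) (φ w) := fun y w => by
    rw [hqXform, LinearMap.compl₁₂_apply, qC_apply]; rfl
  set β : complexBetti X 2 →ₗ[ℂ] complexBetti X 2 →ₗ[ℂ] ℂ :=
    qXform.compl₁₂ F LinearMap.id - (a : ℂ) • qXform with hβraw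
  have hβdef : ∀ y w, β y w =
      k3HilbertForm 2 (φ (F y)) (φ w) - (a : ℂ) * k3HilbertForm 2 (φ y) (φ w) := by
    intro y w
    rw [hβraw, LinearMap.sub_apply, LinearMap.smul_apply, LinearMap.sub_apply, LinearMap.smul_apply,
      LinearMap.compl₁₂_apply, LinearMap.id_apply, hqXapp, hqXapp, smul_eq_mul]
  clear_value β
  have hβsymm : ∀ y w, β y w = β w y := fun y w => by
    rw [hβdef, hβdef, hFadj, k3HilbertForm_comm 2 (φ y) (φ (F w)), k3HilbertForm_comm 2 (φ y) (φ w)]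
  have hqr : ∀ n ∈ algebraicClasses X 1, ∀ y : complexBetti X 2,
      k3HilbertForm 2 (φ n) (φ (y - πT y)) = k3HilbertForm 2 (φ n) (φ y) := by
    intro n hn y
    rw [map_sub, sub_eq_add_neg, k3HilbertForm_add_right, ← neg_one_smul ℂ, k3HilbertForm_smul_right,
      hNT n hn y, mul_zero, add_zero]
  obtain ⟨c', hc'alg, hc'⟩ := exists_algebraicClass_of_symmetricForm hO hcup hX hK hM (a : ℂ) β hβsymm
    (fun y => y - πT y) hT4 hqr
  have hcup3 : ∀ y w : complexBetti X 2, Cup3[c, y, w] = Cup3[c', y, w] := fun y w => by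
    rw [hF, hc', hβ, hβdef]
  exact eq_of_cup3_eq hV hX hK hcup3 ▸ hc'alg

/-- **HC⁴ for marked projective `K3^{[2]}`-type fourfolds with `End_Hdg T(X) = ℚ`, at EVERY Picard rank,
partner-free**, modulo {Verbitsky–Guan, O'Grady, Voisin}: degree `4` by the previous theorem, the others by
Lefschetz `(1,1)` and hard Lefschetz. [cite: Novario2026HodgeClassesHilbertSquares, Thm. 6.2]
[cite: OGrady2008NumericalK3Square, §3] [cite: VoisinHodgeI2002, Thm. 11.30 and Thm. 6.25] -/
theorem hodgeConjectureFor_of_hodgeEndomorphisms_scalar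
    (hV : VerbitskyGuan_cohomology_K3HilbertSquareType) (hO : OGrady2008_dualBBFClass_algebraic)
    (hcup : Voisin2003_cupProduct_algebraicClasses)
    (hX : IsSmoothProjective 4 X) (hK : IsOfK3HilbertSquareType X) (hM : MarkedK3Sq[X, φ, P, z])
    (hQX : hQX[X, φ]) : HodgeConjectureFor 4 X :=
  ⟨nonempty_hodgeModel_holds hX, fun p c hc hH ↦
    hodgeClasses_algebraic_fourfold_of_hodgeTwoTwo lefschetzOneOne_rational_holds
      (nonempty_hardLefschetzNFold_holds 4 X) hX
      (fun _ hc' hH' ↦ mem_algebraicClasses_two_of_hodgeEndomorphisms_scalar hV hO hcup hX hK hM hQX hc' hH')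
      p c hc hH⟩

end Summit.HodgeConjecture.HodgeConjecture.Theorems.MarkmanPartnerTransport.PartnerLattice

end
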